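import Literature.IUT.HodgeArakelov.KummerPrimeStrips
import Literature.IUT.HodgeArakelov.ThetaEvaluationSubgraphs

/-!
# [IUTchII] Def 4.9 (ii) / Cor 3.5–3.6: the splitting monoid `μ_{2l} · q^{j²·ℕ}` at a label, concretely (values)

Owner companion (abc-iut cell, layer L6; abc-iut-L6-t2; no re-typing). S. Mochizuki, *Inter-universal
Teichmüller theory II*, kurims Dec-2020 manuscript:

* Def 4.9 (ii) p. 155: "the `2l`-torsion subgroup `μ_{2l}(‡A) ⊆ O^×(‡A)` …, together with the images of
  the splittings with which `‡F^⊢_w` is equipped, generate a submonoid `O^⊥(‡A) ⊆ O^▷(‡A)`" — typed as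
  `OPerp O 2l splitting` in `KummerPrimeStrips.lean` (p405008);
* the splitting at a bad place is generated by (the image of) the `2l`-th root `q_v` of the `q`-parameter
  ([IUTchI] Ex 3.2 (iv)/(v): "`q_v := q_v^{1/2l}`", "`τ^⊢_v` … a `μ_{2l}(−)`-orbit of characteristic
  splittings"), and in the Gaussian / `Θ^{×μ}_{gau}` context the component at the label `j` is generated
  by the theta value `q_v^{j²}` (Rmk 2.5.1 (i) p. 72; Cor 3.5 (ii) p. 94 `Ψ_ξ = Ψ^× · ξ^ℕ` with
  `ξ_j ∈ μ_{2l} · q^{j²}`; Rmk 3.6.2 (iii) / Rmk 4.11.1 "`q ↦ q^{(1², …, (l⋇)²)}`").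

This file names the resulting CONCRETE submonoid for an element `q` of any commutative monoid `K`
(e.g. `K_v`, `𝒪_{K_v}`, or a tensor-packet ring receiving `K_v`):
`splittingMonoidAt K 2l q j := OPerp K 2l (powers (q^{j²})) = μ_{2l}(K) · q^{j²·ℕ}`, proves the membership
description, that every theta value `ζ · q^{j²}` of `thetaValueAt` lies in it, its behaviour under monoid
homomorphisms (so it can be pushed into any ring receiving `K_v`), and the "acts multiplicatively on a
submodule" lemma in the shape used downstream ([IUTchIII] Prop 3.4 (ii) p. 103 "acts multiplicatively on
`𝓘^ℚ(…)`" is stated there over the LGP-monoids; here only the elementary closure fact: a set stable under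
multiplication by `q^{j²}` and by `μ_{2l}` is stable under the whole splitting monoid).

Claim key `Mochizuki2012` DISPUTED (D-0012): elementary monoid algebra; nothing here asserts a disputed
claim or takes a side on [IUTchIII] Cor 3.12.
-/

namespace Literature.IUT.HodgeArakelov

universe u v

section Monoid

variable (K : Type u) [CommMonoid K]

/-- **The splitting monoid at the label `j`**: `μ_{2l}(K) · (q^{j²})^ℕ ⊆ K`, i.e. `O^⊥` of [IUTchII] Def 4.9 (ii)
p. 155 (`OPerp`) for the splitting generated by the theta value `q^{j²}` ([IUTchI] Ex 3.2 (v); [IUTchII]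
Rmk 2.5.1 (i), Cor 3.5 (ii)). [cite: Mochizuki2012, Def 4.9 (ii) p.155] -/
def splittingMonoidAt (twoL : ℕ) (q : K) (j : ℕ) : Submonoid K :=
  OPerp K twoL (Submonoid.powers (q ^ j ^ 2))

variable {K}

/-- Membership: `x ∈ μ_{2l} · q^{j²·ℕ}` iff `x = ζ · (q^{j²})^n` with `ζ^{2l} = 1` ([IUTchII] Def 4.9 (ii)
p. 155 "generate a submonoid"). [cite: Mochizuki2012, Def 4.9 (ii) p.155] -/
theorem mem_splittingMonoidAt_iff (twoL : ℕ) (q : K) (j : ℕ) (x : K) :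
    x ∈ splittingMonoidAt K twoL q j ↔
      ∃ ζ : Kˣ, ζ ∈ rootsOfUnity twoL K ∧ ∃ n : ℕ, x = (ζ : K) * (q ^ j ^ 2) ^ n := by
  unfold splittingMonoidAt OPerp
  rw [Submonoid.mem_sup]
  constructor
  · rintro ⟨a, ha, b, hb, rfl⟩
    rw [Submonoid.mem_map] at ha
    obtain ⟨ζ, hζ, rfl⟩ := ha
    obtain ⟨n, rfl⟩ := hb
    exact ⟨ζ, hζ, n, rfl⟩
  · rintro ⟨ζ, hζ, n, rfl⟩
    exact ⟨(ζ : K), Submonoid.mem_map.mpr ⟨ζ, hζ, rfl⟩, (q ^ j ^ 2) ^ n, ⟨n, rfl⟩, rfl⟩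

/-- The powers `(q^{j²})^n` lie in the splitting monoid. [cite: Mochizuki2012, Def 4.9 (ii) p.155] -/
theorem pow_mem_splittingMonoidAt (twoL : ℕ) (q : K) (j n : ℕ) :
    (q ^ j ^ 2) ^ n ∈ splittingMonoidAt K twoL q j :=
  splitting_le_OPerp K twoL _ ⟨n, rfl⟩

/-- The theta value `q^{j²}` itself lies in the splitting monoid. [cite: Mochizuki2012, Rmk 2.5.1 (i) p.72] -/
theorem thetaPower_mem_splittingMonoidAt (twoL : ℕ) (q : K) (j : ℕ) :
    q ^ j ^ 2 ∈ splittingMonoidAt K twoL q j := by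
  simpa using pow_mem_splittingMonoidAt twoL q j 1

/-- The `2l`-th roots of unity lie in the splitting monoid ([IUTchII] Def 4.9 (ii) p. 155 "`μ_{2l}(‡A) ⊆ O^⊥(‡A)`").
[cite: Mochizuki2012, Def 4.9 (ii) p.155] -/
theorem root_mem_splittingMonoidAt (twoL : ℕ) (q : K) (j : ℕ) {ζ : Kˣ} (hζ : ζ ∈ rootsOfUnity twoL K) :
    (ζ : K) ∈ splittingMonoidAt K twoL q j :=
  rootsOfUnity_mem_OPerp K twoL _ ζ hζ

/-- At the label `j = 1` ("may be naturally identified with the identity", Rmk 4.10.3 (iii)) — and in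
general for `twoL = 1` (no roots adjoined, the good-place convention of Def 4.9 (iv)) — the splitting
monoid is just `q^{j²·ℕ}`. [cite: Mochizuki2012, Def 4.9 (iv) p.156] -/
theorem splittingMonoidAt_one (q : K) (j : ℕ) :
    splittingMonoidAt K 1 q j = Submonoid.powers (q ^ j ^ 2) :=
  OPerp_one K _

/-- **Functoriality**: a monoid homomorphism `f : K → R` carries the splitting monoid of `q` into that of
`f q` (roots of unity map to roots of unity) — so `μ_{2l}·q_v^{j²·ℕ} ⊆ K_v` may be pushed into any monoid /
ring receiving `K_v` (the log-shell / tensor-packet carriers of [IUTchIII] §3). [cite: Mochizuki2012, Def 4.9 (ii) p.155] -/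
theorem map_splittingMonoidAt_le {R : Type v} [CommMonoid R] (f : K →* R) (twoL : ℕ) (q : K) (j : ℕ) :
    (splittingMonoidAt K twoL q j).map f ≤ splittingMonoidAt R twoL (f q) j := by
  rintro _ ⟨x, hx, rfl⟩
  rw [SetLike.mem_coe, mem_splittingMonoidAt_iff] at hx
  obtain ⟨ζ, hζ, n, rfl⟩ := hx
  rw [map_mul, map_pow, map_pow]
  refine Submonoid.mul_mem _ (root_mem_splittingMonoidAt twoL (f q) j (ζ := Units.map f ζ) ?_)
    (pow_mem_splittingMonoidAt twoL (f q) j n)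
  rw [mem_rootsOfUnity] at hζ ⊢
  rw [← map_pow, hζ, map_one]

/-- **"Acts multiplicatively"** (the closure fact behind [IUTchIII] Prop 3.4 (ii) p. 103 "… acts
multiplicatively on `𝓘^ℚ(…)`" as used for the splitting monoids; here purely elementary): a subset `M` of a
commutative monoid stable under multiplication by `q^{j²}` and by every `2l`-th root of unity is stable
under multiplication by every element of `μ_{2l} · q^{j²·ℕ}`. [cite: Mochizuki2012, Def 4.9 (ii) p.155] -/
theorem splittingMonoidAt_mul_mem {twoL : ℕ} {q : K} {j : ℕ} {M : Set K}
    (hq : ∀ m ∈ M, q ^ j ^ 2 * m ∈ M)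
    (hμ : ∀ ζ : Kˣ, ζ ∈ rootsOfUnity twoL K → ∀ m ∈ M, (ζ : K) * m ∈ M)
    {x : K} (hx : x ∈ splittingMonoidAt K twoL q j) {m : K} (hm : m ∈ M) : x * m ∈ M := by
  rw [mem_splittingMonoidAt_iff] at hx
  obtain ⟨ζ, hζ, n, rfl⟩ := hx
  have hpow : ∀ k : ℕ, ∀ m ∈ M, (q ^ j ^ 2) ^ k * m ∈ M := by
    intro k
    induction k with
    | zero => intro m hm; simpa using hm
    | succ k ih =>
      intro m hm
      rw [pow_succ, mul_assoc]
      exact ih _ (hq m hm)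
  rw [mul_assoc]
  exact hμ ζ hζ _ (hpow n m hm)

end Monoid

/-! ### The theta values of Remark 2.5.1 (i) lie in the splitting monoid -/

section ThetaValues

variable {K : Type u} [CommMonoid K] [DecidableEq Kˣ] (twoL : ℕ) [Fintype (rootsOfUnity twoL Kˣ)]

/-- Every element `ζ · q^{j²}` of the `μ_{2l}`-orbit `θ^j = thetaValueAt (2l) q j` (read in `K` via
`Kˣ ⊆ K`, [IUTchII] Rmk 2.5.1 (i) p. 72) lies in the splitting monoid `μ_{2l} · q^{j²·ℕ}` at the label `j`
(Cor 3.5 (ii) p. 94: the value-profile components generate the Gaussian monoid together with the units).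
[cite: Mochizuki2012, Cor 3.5 (ii) p.94] -/
theorem val_mem_splittingMonoidAt_of_mem_thetaValueAt (q : Kˣ) (j : ℕ) {x : Kˣ}
    (hx : x ∈ thetaValueAt twoL q j) : (x : K) ∈ splittingMonoidAt K twoL (q : K) j := by
  obtain ⟨ζ, rfl⟩ := (mem_thetaValueAt twoL q j x).mp hx
  rw [Units.val_mul, Units.val_pow_eq_pow_val]
  refine Submonoid.mul_mem _ ?_ (thetaPower_mem_splittingMonoidAt twoL (q : K) j)
  refine root_mem_splittingMonoidAt twoL (q : K) j (ζ := ((ζ : Kˣˣ) : Kˣ)) ?_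
  have h := ζ.2
  rw [mem_rootsOfUnity] at h ⊢
  have h' := congrArg (fun u : Kˣˣ => ((u : Kˣˣ) : Kˣ)) h
  simpa using h'

end ThetaValues

end Literature.IUT.HodgeArakelov
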